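import Mathlib.Analysis.SpecialFunctions.Gaussian.GaussianIntegral
import Mathlib.MeasureTheory.Integral.Pi
import Literature.Barriers.CriticalPhenomena.RigorousRGSmallParameter
import HarnessLib

/-!
# The long-range `|φ|⁴` model of `RigorousRGSmallParameter` is well posed: `Z_{g,ν,N} < ∞`,
# the Gibbs measure is a probability measure, and the susceptibility observable is integrable

Companion ("Proofs") file of `Literature/Barriers/CriticalPhenomena/RigorousRGSmallParameter.lean`
(Slade, CMP 358 (2018), arXiv:1611.06169, §1.2). That file transcribes the finite-volume model —
`LongRangePhi4.potential` (`V(φ) = Σ_x (¼g|φ_x|⁴ + ½ν|φ_x|² + ½φ_x·((-Δ_Λ)^{α/2}φ)_x)`),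
`LongRangePhi4.gibbsMeasure` (`e^{-V}dφ/Z` as Mathlib's exponential tilt of Lebesgue measure, which
is the ZERO measure when `e^{-V}` is not integrable), `LongRangePhi4.expect`,
`LongRangePhi4.torusSusceptibility` — and asserts nothing about them. Here we prove the
stability estimate behind "The partition function is defined by `Z_{g,ν,N} = ∫ e^{-V(φ)}dφ`"
(§1.2): for `g > 0` (the paper's standing "Given `g > 0` and `ν ∈ ℝ`"); the argument uses
only that the coupling `((-Δ_Λ)^{α/2})_{xy}` is some real matrix on the finite torus (so it does
not depend on the summability behind the `tsum` defining the periodised kernel):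
* `potential_lower_bound`: `V(φ) ≥ (g/16)Σ_{x,i}(φ_xⁱ)⁴ + Σ_x|φ_x|² - D` for some constant `D`
  (the quartic term dominates: `¼gq² - Aq ≥ ⅛gq² - 2A²/g` and `(g/16)q² ≥ q - 4/g`, `q = |φ_x|²`,
  `A = ½|ν| + ½Σ_{x,y}|M_{xy}|`, using `|Σ_{x,i}φ_xⁱ(Mφ)_xⁱ| ≤ (Σ_{x,y}|M_{xy}|)·Σ_z|φ_z|²`);
* `integrable_mul_exp_neg_potential`: `F e^{-V}` is Lebesgue integrable whenever `F` is continuous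
  with `|F(φ)| ≤ 1 + Σ_x|φ_x|²` (domination by `e^{D}∏_{x,i}e^{-(g/16)(φ_xⁱ)⁴}`, a product of
  one-dimensional integrable factors, Mathlib's `Integrable.fintype_prod`);
* `isProbabilityMeasure_gibbsMeasure`: `⟨·⟩_{g,ν,N}` is a probability measure (so the tilt is not
  the degenerate zero measure), and `expect_eq_integral_div`: `⟨F⟩ = Z⁻¹∫Fe^{-V}dφ` literally;
* `integrable_susceptibilityObservable`: `φ ↦ φ₀·φ_x` is `⟨·⟩_{g,ν,N}`-integrable, so
  `torusSusceptibility` is a genuine expectation (Bochner integrals of non-integrable functions are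
  `0` in Mathlib).
These are the non-vacuity facts about the transcribed objects that any discharge of
`LongRangePhi4.Slade2017_thm141` starts from; no statement of the barrier file is touched.
-/

noncomputable section

namespace Literature.Barriers.CriticalPhenomena

open _root_.MeasureTheory Finset Literature.Probability.LatticeModels

namespace LongRangePhi4

variable {d M n : ℕ}

/-! ### One-dimensional and product integrability of `e^{-a t⁴}` -/

/-- `t ↦ e^{-a t⁴}` is Lebesgue integrable for `a > 0` (dominated by `e^{a}e^{-2a t²}`, since
`t⁴ ≥ 2t² - 1`). [folklore] -/
theorem integrable_exp_neg_mul_pow_four {a : ℝ} (ha : 0 < a) :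
    Integrable (fun t : ℝ => Real.exp (-(a * t ^ 4))) := by
  have hdom : ∀ t : ℝ, Real.exp (-(a * t ^ 4)) ≤ Real.exp a * Real.exp (-(2 * a) * t ^ 2) := by
    intro t
    rw [← Real.exp_add, Real.exp_le_exp]
    have : 2 * t ^ 2 - 1 ≤ t ^ 4 := by nlinarith [sq_nonneg (t ^ 2 - 1)]
    nlinarith
  refine ((integrable_exp_neg_mul_sq (by linarith : 0 < 2 * a)).const_mul (Real.exp a)).mono'
    (by fun_prop : Continuous fun t : ℝ => Real.exp (-(a * t ^ 4))).aestronglyMeasurable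
    (Filter.Eventually.of_forall fun t => ?_)
  rw [Real.norm_of_nonneg (Real.exp_pos _).le]
  exact hdom t

/-- `v ↦ ∏_i e^{-a vᵢ⁴}` is integrable on `ℝ^ι` (`ι` finite). [folklore] -/
theorem integrable_prod_exp_neg_mul_pow_four {ι : Type*} [Fintype ι] {a : ℝ} (ha : 0 < a) :
    Integrable (fun v : ι → ℝ => ∏ i, Real.exp (-(a * v i ^ 4))) := by
  have h := Integrable.fintype_prod (ι := ι) (f := fun (_ : ι) (t : ℝ) => Real.exp (-(a * t ^ 4)))
    (μ := fun _ => (volume : Measure ℝ)) fun _ => integrable_exp_neg_mul_pow_four ha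
  rw [← volume_pi] at h
  exact h

/-- `φ ↦ ∏_x ∏_i e^{-a (φ_xⁱ)⁴}` is integrable on `(ℝ^κ)^ι` (`ι, κ` finite). [folklore] -/
theorem integrable_prod_prod_exp_neg_mul_pow_four {ι κ : Type*} [Fintype ι] [Fintype κ] {a : ℝ}
    (ha : 0 < a) :
    Integrable (fun φ : ι → κ → ℝ => ∏ x, ∏ i, Real.exp (-(a * φ x i ^ 4))) := by
  have h := Integrable.fintype_prod (ι := ι)
    (f := fun (_ : ι) (v : κ → ℝ) => ∏ i, Real.exp (-(a * v i ^ 4)))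
    (μ := fun _ => (volume : Measure (κ → ℝ))) fun _ => integrable_prod_exp_neg_mul_pow_four ha
  rw [← volume_pi] at h
  exact h

/-! ### The stability (lower) bound on `V` -/

/-- `Σ_i a_i⁴ ≤ (Σ_i a_i²)²`. [folklore] -/
theorem sum_pow_four_le_sq_sqNorm (v : Fin n → ℝ) : ∑ i, v i ^ 4 ≤ sqNorm v ^ 2 := by
  unfold sqNorm
  rw [sq, Finset.sum_mul]
  refine Finset.sum_le_sum fun i _ => ?_
  calc v i ^ 4 = v i ^ 2 * v i ^ 2 := by ring
    _ ≤ v i ^ 2 * ∑ j, v j ^ 2 :=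
        mul_le_mul_of_nonneg_left
          (Finset.single_le_sum (fun j _ => sq_nonneg (v j)) (Finset.mem_univ i)) (sq_nonneg _)

/-- `|Σ_i a_i b_i| ≤ ½(|a|² + |b|²)`. [folklore] -/
theorem abs_sum_mul_le_half (v w : Fin n → ℝ) :
    |∑ i, v i * w i| ≤ (sqNorm v + sqNorm w) / 2 := by
  unfold sqNorm
  rw [abs_le]
  constructor
  · have h : 0 ≤ ∑ i, (v i + w i) ^ 2 := Finset.sum_nonneg fun i _ => sq_nonneg _
    have e : ∑ i, (v i + w i) ^ 2 = ∑ i, v i ^ 2 + ∑ i, w i ^ 2 + 2 * ∑ i, v i * w i := by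
      rw [Finset.mul_sum, ← Finset.sum_add_distrib, ← Finset.sum_add_distrib]
      exact Finset.sum_congr rfl fun i _ => by ring
    linarith
  · have h : 0 ≤ ∑ i, (v i - w i) ^ 2 := Finset.sum_nonneg fun i _ => sq_nonneg _
    have e : ∑ i, (v i - w i) ^ 2 = ∑ i, v i ^ 2 + ∑ i, w i ^ 2 - 2 * ∑ i, v i * w i := by
      rw [Finset.mul_sum, ← Finset.sum_add_distrib, ← Finset.sum_sub_distrib]
      exact Finset.sum_congr rfl fun i _ => by ring
    linarith

/-- The interaction term is bounded by the total square: for any real matrix `K` on a finite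
index set, `|Σ_x Σ_i φ_xⁱ Σ_y K_{xy} φ_yⁱ| ≤ (Σ_x Σ_y |K_{xy}|) · Σ_z |φ_z|²`. [folklore] -/
theorem abs_interaction_le {ι : Type*} [Fintype ι] (K : ι → ι → ℝ) (φ : ι → Fin n → ℝ) :
    |∑ x, ∑ i, φ x i * ∑ y, K x y * φ y i| ≤ (∑ x, ∑ y, |K x y|) * ∑ z, sqNorm (φ z) := by
  set S : ℝ := ∑ z, sqNorm (φ z) with hS
  have hSx : ∀ x, sqNorm (φ x) ≤ S := fun x =>
    Finset.single_le_sum (fun z _ => sqNorm_nonneg (φ z)) (Finset.mem_univ x)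
  have hx : ∀ x, |∑ i, φ x i * ∑ y, K x y * φ y i| ≤ (∑ y, |K x y|) * S := by
    intro x
    have e : ∑ i, φ x i * ∑ y, K x y * φ y i = ∑ y, K x y * ∑ i, φ x i * φ y i := by
      simp_rw [Finset.mul_sum]
      rw [Finset.sum_comm]
      exact Finset.sum_congr rfl fun y _ => Finset.sum_congr rfl fun i _ => by ring
    rw [e, Finset.sum_mul]
    refine (Finset.abs_sum_le_sum_abs _ _).trans (Finset.sum_le_sum fun y _ => ?_)
    rw [abs_mul]
    refine mul_le_mul_of_nonneg_left ?_ (abs_nonneg _)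
    have := abs_sum_mul_le_half (φ x) (φ y)
    linarith [hSx x, hSx y]
  rw [Finset.sum_mul]
  exact (Finset.abs_sum_le_sum_abs _ _).trans (Finset.sum_le_sum fun x _ => hx x)

/-- The elementary quadratic-versus-quartic bookkeeping: for `g > 0`, `q ≥ 0`, any `A`,
`¼gq² - Aq ≥ (g/16)q² + q - (2A²/g + 4/g)` (from `(gq-4A)² ≥ 0` and `(gq-8)² ≥ 0`). [folklore] -/
theorem quartic_dominates {g A q : ℝ} (hg : 0 < g) :
    g / 16 * q ^ 2 + q - (2 * A ^ 2 / g + 4 / g) ≤ g / 4 * q ^ 2 - A * q := by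
  have h1 : 0 ≤ (g * q - 4 * A) ^ 2 / (8 * g) := div_nonneg (sq_nonneg _) (by positivity)
  have h2 : 0 ≤ (g * q - 8) ^ 2 / (16 * g) := div_nonneg (sq_nonneg _) (by positivity)
  have e1 : (g * q - 4 * A) ^ 2 / (8 * g) = g / 8 * q ^ 2 - A * q + 2 * A ^ 2 / g := by
    field_simp
    ring
  have e2 : (g * q - 8) ^ 2 / (16 * g) = g / 16 * q ^ 2 - q + 4 / g := by
    field_simp
    ring
  rw [e1] at h1
  rw [e2] at h2
  linarith

/-- **Stability bound** ("the quartic term dominates"): for `g > 0` there is a constant `D`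
(namely `|Λ|·(2A²/g + 4/g)`, `A = ½|ν| + ½Σ_{x,y}|((-Δ_Λ)^{α/2})_{xy}|`) with
`V(φ) ≥ (g/16)Σ_xΣ_i(φ_xⁱ)⁴ + Σ_x|φ_x|² - D` for all `φ`. [folklore] -/
theorem potential_lower_bound [NeZero M] {α g ν : ℝ} (hg : 0 < g) :
    ∃ D : ℝ, ∀ φ : TorusSite d M → Fin n → ℝ,
      g / 16 * ∑ x, ∑ i, φ x i ^ 4 + ∑ x, sqNorm (φ x) - D ≤ potential d M n α g ν φ := by
  refine ⟨(Fintype.card (TorusSite d M) : ℝ) *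
    (2 * (|ν| / 2 + (∑ x : TorusSite d M, ∑ y, |fracLaplacianTorus d (α / 2) M x y|) / 2) ^ 2 / g
      + 4 / g), fun φ => ?_⟩
  set K : TorusSite d M → TorusSite d M → ℝ := fun x y => fracLaplacianTorus d (α / 2) M x y
    with hK
  set B : ℝ := ∑ x, ∑ y, |K x y| with hB
  set A : ℝ := |ν| / 2 + B / 2 with hA
  set S : ℝ := ∑ z, sqNorm (φ z) with hS
  have hS0 : 0 ≤ S := Finset.sum_nonneg fun z _ => sqNorm_nonneg (φ z)
  have hB0 : 0 ≤ B := Finset.sum_nonneg fun x _ => Finset.sum_nonneg fun y _ => abs_nonneg _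
  -- the interaction and mass terms against `-A·S`
  have hint : -(B * S) ≤ ∑ x, ∑ i, φ x i * ∑ y, K x y * φ y i :=
    (neg_le.1 (neg_le_abs _)).trans' (neg_le_neg (abs_interaction_le K φ)) |>.trans (le_refl _)
  have hmass : -(|ν| * S) ≤ ν * S := by
    have := neg_abs_le ν
    nlinarith
  -- `V = Σ_x ¼g q_x² + ½ν S + ½·interaction`
  have hV : potential d M n α g ν φ =
      ∑ x, g / 4 * sqNorm (φ x) ^ 2 + ν / 2 * S +
        1 / 2 * ∑ x, ∑ i, φ x i * ∑ y, K x y * φ y i := by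
    unfold potential
    rw [Finset.sum_add_distrib, Finset.sum_add_distrib, hS, Finset.mul_sum, Finset.mul_sum]
  -- per-site bookkeeping
  have hsite : ∀ x, g / 16 * ∑ i, φ x i ^ 4 + sqNorm (φ x) - (2 * A ^ 2 / g + 4 / g)
      ≤ g / 4 * sqNorm (φ x) ^ 2 - A * sqNorm (φ x) := by
    intro x
    have h4 := sum_pow_four_le_sq_sqNorm (φ x)
    have hq := quartic_dominates (A := A) (q := sqNorm (φ x)) hg
    nlinarith [hg.le]
  have hL : ∑ x, (g / 16 * ∑ i, φ x i ^ 4 + sqNorm (φ x) - (2 * A ^ 2 / g + 4 / g)) =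
      g / 16 * ∑ x, ∑ i, φ x i ^ 4 + S -
        (Fintype.card (TorusSite d M) : ℝ) * (2 * A ^ 2 / g + 4 / g) := by
    rw [Finset.sum_sub_distrib, Finset.sum_add_distrib, ← Finset.mul_sum, Finset.sum_const,
      Finset.card_univ, nsmul_eq_mul, hS]
  have hR : ∑ x, (g / 4 * sqNorm (φ x) ^ 2 - A * sqNorm (φ x)) =
      ∑ x, g / 4 * sqNorm (φ x) ^ 2 - A * S := by
    rw [Finset.sum_sub_distrib, hS]
    congr 1
    rw [Finset.mul_sum]
  have hsum : g / 16 * ∑ x, ∑ i, φ x i ^ 4 + S -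
        (Fintype.card (TorusSite d M) : ℝ) * (2 * A ^ 2 / g + 4 / g)
      ≤ ∑ x, g / 4 * sqNorm (φ x) ^ 2 - A * S := by
    rw [← hL, ← hR]
    exact Finset.sum_le_sum fun x _ => hsite x
  have hD : (Fintype.card (TorusSite d M) : ℝ) *
      (2 * (|ν| / 2 + (∑ x : TorusSite d M, ∑ y, |fracLaplacianTorus d (α / 2) M x y|) / 2) ^ 2
        / g + 4 / g) = (Fintype.card (TorusSite d M) : ℝ) * (2 * A ^ 2 / g + 4 / g) := by
    rw [hA, hB]
  rw [hD, hV]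
  have hAS : A * S = |ν| / 2 * S + B / 2 * S := by rw [hA]; ring
  linarith [hint, hmass, hsum, hAS]

/-! ### Integrability of `F e^{-V}` and the Gibbs probability measure -/

/-- `V` is continuous (a polynomial in the coordinates). [folklore] -/
theorem continuous_potential [NeZero M] (α g ν : ℝ) :
    Continuous (potential d M n α g ν) := by
  unfold potential sqNorm
  fun_prop

/-- **`F e^{-V}` is Lebesgue integrable** for `g > 0` whenever `F` is continuous with
`|F(φ)| ≤ 1 + Σ_x|φ_x|²`: by the stability bound,
`|F|e^{-V} ≤ (1+S)e^{-S}e^{D}∏_{x,i}e^{-(g/16)(φ_xⁱ)⁴} ≤ e^{D}∏_{x,i}e^{-(g/16)(φ_xⁱ)⁴}`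
(`S = Σ_x|φ_x|²`, `1 + S ≤ e^{S}`). In particular (with `F = 1`) the partition function
`Z_{g,ν,N} = ∫e^{-V}dφ` of Slade §1.2 is finite. [cite: Slade2017, §1.2 (partition function)] -/
theorem integrable_mul_exp_neg_potential [NeZero M] {α g ν : ℝ} (hg : 0 < g)
    {F : (TorusSite d M → Fin n → ℝ) → ℝ} (hF : Continuous F)
    (hbound : ∀ φ, |F φ| ≤ 1 + ∑ x, sqNorm (φ x)) :
    Integrable (fun φ => F φ * Real.exp (-potential d M n α g ν φ)) := by
  obtain ⟨D, hVD⟩ := potential_lower_bound (d := d) (M := M) (n := n) (α := α) (ν := ν) hg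
  have hg16 : 0 < g / 16 := by positivity
  refine ((integrable_prod_prod_exp_neg_mul_pow_four (ι := TorusSite d M) (κ := Fin n)
    hg16).const_mul (Real.exp D)).mono'
    (hF.mul (Real.continuous_exp.comp (continuous_potential α g ν).neg)).aestronglyMeasurable
    (Filter.Eventually.of_forall fun φ => ?_)
  set S : ℝ := ∑ x, sqNorm (φ x) with hS
  have hS0 : 0 ≤ S := Finset.sum_nonneg fun z _ => sqNorm_nonneg (φ z)
  have hV := hVD φ
  rw [← hS] at hV
  -- `e^{-V} ≤ e^{D} e^{-S} ∏ e^{-(g/16)φ⁴}`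
  have hexp : Real.exp (-potential d M n α g ν φ) ≤
      Real.exp D * Real.exp (-S) * ∏ x, ∏ i, Real.exp (-(g / 16 * φ x i ^ 4)) := by
    have e : Real.exp D * Real.exp (-S) * ∏ x, ∏ i, Real.exp (-(g / 16 * φ x i ^ 4)) =
        Real.exp (D - S - g / 16 * ∑ x, ∑ i, φ x i ^ 4) := by
      rw [show D - S - g / 16 * ∑ x, ∑ i, φ x i ^ 4 =
          D + -S + ∑ x, ∑ i, -(g / 16 * φ x i ^ 4) by
        rw [Finset.mul_sum]
        simp_rw [Finset.mul_sum, Finset.sum_neg_distrib]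
        ring]
      rw [Real.exp_add, Real.exp_add, Real.exp_sum]
      simp_rw [Real.exp_sum]
    rw [e, Real.exp_le_exp]
    linarith
  -- `|F| e^{-S} ≤ 1`
  have hFS : |F φ| * Real.exp (-S) ≤ 1 := by
    have h1 : |F φ| ≤ 1 + S := hbound φ
    have h2 : 1 + S ≤ Real.exp S := by linarith [Real.add_one_le_exp S]
    rw [Real.exp_neg, ← div_eq_mul_inv, div_le_one (Real.exp_pos S)]
    exact h1.trans h2
  have hP0 : 0 ≤ ∏ x, ∏ i, Real.exp (-(g / 16 * φ x i ^ 4)) :=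
    Finset.prod_nonneg fun x _ => Finset.prod_nonneg fun i _ => (Real.exp_pos _).le
  rw [norm_mul, Real.norm_eq_abs, Real.norm_of_nonneg (Real.exp_pos _).le]
  calc |F φ| * Real.exp (-potential d M n α g ν φ)
      ≤ |F φ| * (Real.exp D * Real.exp (-S) * ∏ x, ∏ i, Real.exp (-(g / 16 * φ x i ^ 4))) :=
        mul_le_mul_of_nonneg_left hexp (abs_nonneg _)
    _ = (|F φ| * Real.exp (-S)) * (Real.exp D * ∏ x, ∏ i, Real.exp (-(g / 16 * φ x i ^ 4))) := by
        ring
    _ ≤ 1 * (Real.exp D * ∏ x, ∏ i, Real.exp (-(g / 16 * φ x i ^ 4))) :=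
        mul_le_mul_of_nonneg_right hFS (mul_nonneg (Real.exp_pos _).le hP0)
    _ = Real.exp D * ∏ x, ∏ i, Real.exp (-(g / 16 * φ x i ^ 4)) := one_mul _

/-- `e^{-V}` is Lebesgue integrable for `g > 0`: the partition function
`Z_{g,ν,N} = ∫_{(ℝⁿ)^Λ} e^{-V(φ)}dφ` is finite. [cite: Slade2017, §1.2 (partition function)] -/
theorem integrable_exp_neg_potential [NeZero M] {α g ν : ℝ} (hg : 0 < g) :
    Integrable (fun φ : TorusSite d M → Fin n → ℝ => Real.exp (-potential d M n α g ν φ)) := by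
  have := integrable_mul_exp_neg_potential (α := α) (ν := ν) (n := n) (d := d) (M := M) hg
    (F := fun _ => 1) continuous_const fun φ => by
      rw [abs_one]
      linarith [Finset.sum_nonneg fun z (_ : z ∈ Finset.univ) => sqNorm_nonneg (φ z)]
  simpa using this

/-- **The finite-volume Gibbs measure `⟨·⟩_{g,ν,N}` is a probability measure** for `g > 0`
(so `gibbsMeasure`, defined as an exponential tilt, is not the degenerate zero measure).
[cite: Slade2017, §1.2 (expectation ⟨F⟩_{g,ν,N})] -/
theorem isProbabilityMeasure_gibbsMeasure [NeZero M] {α g ν : ℝ} (hg : 0 < g) :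
    IsProbabilityMeasure (gibbsMeasure d M n α g ν) := by
  unfold gibbsMeasure
  exact isProbabilityMeasure_tilted (integrable_exp_neg_potential hg)

/-- `⟨F⟩_{g,ν,N} = Z⁻¹∫F(φ)e^{-V(φ)}dφ` literally (Mathlib's tilt unfolds to the printed formula).
[cite: Slade2017, §1.2 (expectation ⟨F⟩_{g,ν,N})] -/
theorem expect_eq_integral_div [NeZero M] (α g ν : ℝ) (F : (TorusSite d M → Fin n → ℝ) → ℝ) :
    expect d M n α g ν F =
      (∫ φ, F φ * Real.exp (-potential d M n α g ν φ)) /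
        ∫ φ, Real.exp (-potential d M n α g ν φ) := by
  unfold expect gibbsMeasure
  rw [integral_tilted]
  simp_rw [smul_eq_mul, div_mul_eq_mul_div, mul_comm (Real.exp _)]
  rw [integral_div]

/-- Any continuous observable with `|F(φ)| ≤ 1 + Σ_x|φ_x|²` is `⟨·⟩_{g,ν,N}`-integrable (`g > 0`).
[folklore] -/
theorem integrable_gibbsMeasure_of_abs_le [NeZero M] {α g ν : ℝ} (hg : 0 < g)
    {F : (TorusSite d M → Fin n → ℝ) → ℝ} (hF : Continuous F)
    (hbound : ∀ φ, |F φ| ≤ 1 + ∑ x, sqNorm (φ x)) :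
    Integrable F (gibbsMeasure d M n α g ν) := by
  unfold gibbsMeasure
  rw [integrable_tilted_iff (integrable_exp_neg_potential hg)]
  simp_rw [smul_eq_mul, mul_comm (Real.exp _)]
  exact integrable_mul_exp_neg_potential hg hF hbound

/-- **The susceptibility observable `φ ↦ φ₀·φ_x` is `⟨·⟩_{g,ν,N}`-integrable** for `g > 0`, so each
summand of `torusSusceptibility` is a genuine expectation. [cite: Slade2017, §1.2 (definition of the susceptibility)] -/
theorem integrable_susceptibilityObservable [NeZero M] {α g ν : ℝ} (hg : 0 < g)
    (x : TorusSite d M) :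
    Integrable (fun φ : TorusSite d M → Fin n → ℝ => ∑ i, φ 0 i * φ x i)
      (gibbsMeasure d M n α g ν) := by
  refine integrable_gibbsMeasure_of_abs_le hg (by fun_prop) fun φ => ?_
  have h := abs_sum_mul_le_half (φ 0) (φ x)
  have h0 : sqNorm (φ 0) ≤ ∑ z, sqNorm (φ z) :=
    Finset.single_le_sum (fun z _ => sqNorm_nonneg (φ z)) (Finset.mem_univ 0)
  have hx : sqNorm (φ x) ≤ ∑ z, sqNorm (φ z) :=
    Finset.single_le_sum (fun z _ => sqNorm_nonneg (φ z)) (Finset.mem_univ x)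
  linarith

end LongRangePhi4

end Literature.Barriers.CriticalPhenomena

end
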